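import Summits.HodgeConjecture.HodgeConjecture.Theses.HeckePrymWeil
import Summits.HodgeConjecture.HodgeConjecture.Theorems.HeckePrymWeilWeilSixfoldsSqrtMinus7OneClassSufficesLemmas
import Summits.HodgeConjecture.HodgeConjecture.Theorems.HeckePrymWeilWeilSixfoldsSqrtMinus7OneClassSufficesEigenlines
import Summits.HodgeConjecture.HodgeConjecture.Theorems.WeilSixfoldsSqrtMinus7.Negative.EigenvalueSeparation
import Summits.HodgeConjecture.HodgeConjecture.Theorems.WeilTwelvefoldsSqrtMinus7.Negative.WeilPlaneReality
import Literature.AlgebraicGeometry.HodgeTheory.AbelianVarietyEndomorphismsHOne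
import Literature.AlgebraicGeometry.HodgeTheory.AbelianVarietyPullbackAlgebraicClasses
import Literature.AlgebraicGeometry.HodgeTheory.WeilClassesSixfoldsProofs
import HarnessLib

/-!
# Route HeckePrymWeil · crux `WeilSixfoldsSqrtMinus7` (stmt-HodgeConjecture-1260) · line
# `real-quadratic-base-change` · stub `stub_oneClassSuffices` — part 3/3: CLOSED, unconditional

"ONE CLASS SUFFICES" on a complex abelian 12-fold `B` with two COMMUTING endomorphisms
`ψ_K² = -7`, `ψ_F² = t` (`t > 0` non-square), i.e. multiplication by the CM field `L = ℚ(√-7, √t)`: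
one non-zero rational ALGEBRAIC class `c₀` of the `L`-Weil span — the join of the four joint
eigenspaces of `T_K = (𝟙+ψ_K)^*`, `T_F = (𝟙+ψ_F)^*` on `H⁶(B(ℂ); ℂ)` for `((1 ± i√7)⁶, (1 ± √t)⁶)` —
makes every class of the `L`-Weil span algebraic (Markman, arXiv:2509.23079, §1 p. 2: "it suffices
to prove the algebraicity of one non-zero class in `HW`, as `K` acts via algebraic
correspondences"; van Geemen, LNM 1594, proof of Thm. 6.12). Proof on the carriers:

* the four components of `c₀` are algebraic (`mem_of_sum_eigenvectors_mem`: `T_K`, `T_F` preserve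
  `N³H⁶`, `map_mem_algebraicClasses_of_abelianVariety` — pull-back along ENDOMORPHISMS, Kleiman)
  and ALL NON-ZERO: complex conjugation fixes the rational `c₀` and swaps the `K`-sign of the
  components (`conjClass_mem_eigenspace_map`, uniqueness of the joint decomposition), and a
  non-zero rational eigenvector of `T_F` has a RATIONAL eigenvalue
  (`mem_range_ratCast_of_isRationalClass_of_mem_eigenspace`) while `(1 ± √t)⁶ ∉ ℚ` (part 1/3);
* each of the four joint eigenspaces is a line (part 2/3, `oneClassSuffices_jointEigenline`:
  `H⁶ = ⋀⁶ H¹` and `H¹(B, ℚ)` is free of rank `6` over `L` by the rationality of traces), hence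
  spanned by an algebraic class, and the `L`-Weil span is algebraic.

VERBATIM the registered stub `stub_oneClassSuffices` of the lead's skeleton (c2 reshape r1).
Everything is a theorem; no definition, no named fact.
-/

noncomputable section

-- single-problem summit (Problem = Summit): the mandated namespace repeats `HodgeConjecture`.
set_option linter.dupNamespace false

open CategoryTheory
open Literature.AlgebraicGeometry.Motives Literature.AlgebraicGeometry.HodgeTheory
open Literature.AlgebraicGeometry.Motives.AbelianVariety
open Literature.AlgebraicTopology.SingularHomology

namespace Summit.HodgeConjecture.HodgeConjecture.Theorems.WeilSixfoldsSqrtMinus7.RealQuadraticBaseChange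

open Summit.HodgeConjecture.HodgeConjecture.Theorems.WeilSixfoldsSqrtMinus7.Negative
  (weilEigenvalue_pos_ne_neg)
open Summit.HodgeConjecture.HodgeConjecture.Theorems.WeilTwelvefoldsSqrtMinus7.Negative
  (conjClass_mem_eigenspace_map conj_one_add_I_sqrt7_pow conj_one_sub_I_sqrt7_pow)

/-! ### Rational eigenvectors have rational eigenvalues; conjugation and the `F`-eigenvalues -/

section Rational

variable {B : AbelianVariety ℂ}

/-- **A non-zero RATIONAL eigenvector of a pull-back `f^*` has a RATIONAL eigenvalue**: in a
`ℂ`-basis of `Hᵏ(B(ℂ); ℂ)` made of rational classes (rational classes span,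
`span_isRationalClass_eq_top_of_isSmoothProjective_holds`) both `c` and `f^* c` (rational,
`IsRationalClass.pullback`) have rational coordinates (`repr_mem_range_ratCast_of_isRationalClass`),
and `μ` is the quotient of two of them. [folklore] -/
theorem mem_range_ratCast_of_isRationalClass_of_mem_eigenspace (f : B ⟶ B) {k : ℕ}
    {c : complexBetti B.X k} (hc : IsRationalClass c) (hc0 : c ≠ 0) {μ : ℂ}
    (hμ : c ∈ Module.End.eigenspace (complexBetti.map f.hom.hom.hom k).hom μ) :
    μ ∈ Set.range ((↑) : ℚ → ℂ) := by
  classical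
  haveI := finite_complexBetti_abelianVariety B k
  obtain ⟨w, hws, hwspan, hli⟩ :=
    exists_linearIndependent ℂ {c : complexBetti B.X k | IsRationalClass c}
  have hspan : Submodule.span ℂ {c : complexBetti B.X k | IsRationalClass c} = ⊤ :=
    span_isRationalClass_eq_top_of_isSmoothProjective_holds _ _
      (AbelianVariety.isSmoothProjective_holds (A := B)) k
  haveI : Fintype w := (hli.set_finite_of_isNoetherian).fintype
  let bb : Module.Basis w ℂ (complexBetti B.X k) :=
    Module.Basis.mk hli (by rw [Subtype.range_coe, hwspan, hspan])
  have hbb : ∀ i, IsRationalClass (bb i) := fun i => by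
    rw [Module.Basis.mk_apply]
    exact hws i.2
  -- a non-zero coordinate of `c`
  obtain ⟨i, hi⟩ : ∃ i, bb.repr c i ≠ 0 := by
    by_contra! h
    exact hc0 (bb.repr.map_eq_zero_iff.1 (Finsupp.ext h))
  obtain ⟨q, hq⟩ := repr_mem_range_ratCast_of_isRationalClass bb hbb hc i
  have hfc : IsRationalClass ((complexBetti.map f.hom.hom.hom k).hom c) := hc.pullback _
  obtain ⟨q', hq'⟩ := repr_mem_range_ratCast_of_isRationalClass bb hbb hfc i
  have e : bb.repr ((complexBetti.map f.hom.hom.hom k).hom c) i = μ * bb.repr c i := by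
    rw [Module.End.mem_eigenspace_iff.1 hμ, map_smul, Finsupp.smul_apply, smul_eq_mul]
  rw [← hq, ← hq'] at e
  rw [← hq] at hi
  refine ⟨q' / q, ?_⟩
  have hq0 : (q : ℂ) ≠ 0 := hi
  push_cast
  field_simp
  linear_combination e

/-- Conjugation maps the `(1 + i√7)⁶`-eigenspace of a pull-back `g^*` on `H⁶` into the
`(1 - i√7)⁶`-eigenspace. [cite: VoisinHodgeI2002, Cor. 6.12] -/
theorem conjClass_mem_eigenspace_pos {g : B.X ⟶ B.X} {c : complexBetti B.X 6}
    (hc : c ∈ Module.End.eigenspace (complexBetti.map g 6).hom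
      ((1 + Complex.I * (Real.sqrt (7 : ℝ) : ℂ)) ^ 6)) :
    conjClass (ComplexPoints B.X) 6 c ∈ Module.End.eigenspace (complexBetti.map g 6).hom
      ((1 - Complex.I * (Real.sqrt (7 : ℝ) : ℂ)) ^ 6) := by
  have h := conjClass_mem_eigenspace_map _ hc
  rwa [conj_one_add_I_sqrt7_pow] at h

/-- … and the `(1 - i√7)⁶`-eigenspace into the `(1 + i√7)⁶`-eigenspace.
[cite: VoisinHodgeI2002, Cor. 6.12] -/
theorem conjClass_mem_eigenspace_neg {g : B.X ⟶ B.X} {c : complexBetti B.X 6}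
    (hc : c ∈ Module.End.eigenspace (complexBetti.map g 6).hom
      ((1 - Complex.I * (Real.sqrt (7 : ℝ) : ℂ)) ^ 6)) :
    conjClass (ComplexPoints B.X) 6 c ∈ Module.End.eigenspace (complexBetti.map g 6).hom
      ((1 + Complex.I * (Real.sqrt (7 : ℝ) : ℂ)) ^ 6) := by
  have h := conjClass_mem_eigenspace_map _ hc
  rwa [conj_one_sub_I_sqrt7_pow] at h

/-- Conjugation preserves the eigenspaces of a pull-back for the REAL eigenvalues `(1 ± √t)⁶`.
[cite: VoisinHodgeI2002, Cor. 6.12] -/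
theorem conjClass_mem_eigenspace_real {g : B.X ⟶ B.X} {c : complexBetti B.X 6} {ρ : ℝ}
    (hc : c ∈ Module.End.eigenspace (complexBetti.map g 6).hom ((1 + (ρ : ℂ)) ^ 6)) :
    conjClass (ComplexPoints B.X) 6 c ∈
      Module.End.eigenspace (complexBetti.map g 6).hom ((1 + (ρ : ℂ)) ^ 6) := by
  have h := conjClass_mem_eigenspace_map _ hc
  rwa [map_pow, map_add, map_one, Complex.conj_ofReal] at h

/-- … and for the real eigenvalues written `(1 - ρ)⁶`. [cite: VoisinHodgeI2002, Cor. 6.12] -/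
theorem conjClass_mem_eigenspace_real_sub {g : B.X ⟶ B.X} {c : complexBetti B.X 6} {ρ : ℝ}
    (hc : c ∈ Module.End.eigenspace (complexBetti.map g 6).hom ((1 - (ρ : ℂ)) ^ 6)) :
    conjClass (ComplexPoints B.X) 6 c ∈
      Module.End.eigenspace (complexBetti.map g 6).hom ((1 - (ρ : ℂ)) ^ 6) := by
  have h := conjClass_mem_eigenspace_map _ hc
  rwa [map_pow, map_sub, map_one, Complex.conj_ofReal] at h

end Rational

/-! ### The stub: one non-zero rational algebraic `L`-Weil class makes the `L`-Weil span algebraic -/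

section Stub

/-- **STUB `stub_oneClassSuffices` (ONE CLASS SUFFICES; Lieberman-type, two operators), CLOSED.**
On a complex abelian 12-fold `B` with commuting `ψ_K² = -7`, `ψ_F² = t` (`t > 0` non-square): one
non-zero rational ALGEBRAIC class `c₀` of the `L`-Weil span — the join of the four joint
eigenspaces of `(𝟙+ψ_K)^*`, `(𝟙+ψ_F)^*` on `H⁶(B(ℂ); ℂ)` for `((1 ± i√7)⁶, (1 ± √t)⁶)` — makes
every class of the `L`-Weil span algebraic (the rationality and Hodge-type hypotheses on the
final class are not even needed). Proof: the four components of `c₀` are algebraic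
(`mem_of_sum_eigenvectors_mem`; `(𝟙+ψ)^*` preserves `N³H⁶`,
`map_mem_algebraicClasses_of_abelianVariety`)
and non-zero (conjugation fixes `c₀` and swaps the `K`-signs; a non-zero rational eigenvector of
`(𝟙+ψ_F)^*` would have a rational eigenvalue, but `(1 ± √t)⁶ ∉ ℚ`), and each joint eigenspace is a
line (`oneClassSuffices_jointEigenline`, part 2/3), hence spanned by an algebraic class.
[cite: Markman2025SecantRealMultiplication, §1 p. 2]
[cite: vanGeemen1994HodgeAV, proof of Thm. 6.12] -/
theorem stub_oneClassSuffices :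
    ∀ (B : AbelianVariety ℂ) (ψK ψF : B ⟶ B) (t : ℕ), B.dim = 12 → ψK ≫ ψK = -((7 : ℤ) • 𝟙 B) →
      ψF ≫ ψF = (t : ℤ) • 𝟙 B → ψK ≫ ψF = ψF ≫ ψK → 0 < t → ¬ IsSquare t →
      (∃ c₀ : complexBetti B.X 6, IsRationalClass c₀ ∧
          c₀ ∈ ((Module.End.eigenspace (complexBetti.map (𝟙 B + ψK).hom.hom.hom 6).hom
                    ((1 + Complex.I * (Real.sqrt (7 : ℝ) : ℂ)) ^ 6) ⊓
                  Module.End.eigenspace (complexBetti.map (𝟙 B + ψF).hom.hom.hom 6).hom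
                    ((1 + (Real.sqrt (t : ℝ) : ℂ)) ^ 6)) ⊔
                (Module.End.eigenspace (complexBetti.map (𝟙 B + ψK).hom.hom.hom 6).hom
                    ((1 + Complex.I * (Real.sqrt (7 : ℝ) : ℂ)) ^ 6) ⊓
                  Module.End.eigenspace (complexBetti.map (𝟙 B + ψF).hom.hom.hom 6).hom
                    ((1 - (Real.sqrt (t : ℝ) : ℂ)) ^ 6))) ⊔
               ((Module.End.eigenspace (complexBetti.map (𝟙 B + ψK).hom.hom.hom 6).hom
                    ((1 - Complex.I * (Real.sqrt (7 : ℝ) : ℂ)) ^ 6) ⊓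
                  Module.End.eigenspace (complexBetti.map (𝟙 B + ψF).hom.hom.hom 6).hom
                    ((1 + (Real.sqrt (t : ℝ) : ℂ)) ^ 6)) ⊔
                (Module.End.eigenspace (complexBetti.map (𝟙 B + ψK).hom.hom.hom 6).hom
                    ((1 - Complex.I * (Real.sqrt (7 : ℝ) : ℂ)) ^ 6) ⊓
                  Module.End.eigenspace (complexBetti.map (𝟙 B + ψF).hom.hom.hom 6).hom
                    ((1 - (Real.sqrt (t : ℝ) : ℂ)) ^ 6))) ∧
          c₀ ≠ 0 ∧ c₀ ∈ algebraicClasses B.X 3) →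
      ∀ c : complexBetti B.X 6, IsRationalClass c → IsOfHodgeType 12 B.X 6 3 3 c →
        c ∈ ((Module.End.eigenspace (complexBetti.map (𝟙 B + ψK).hom.hom.hom 6).hom
                  ((1 + Complex.I * (Real.sqrt (7 : ℝ) : ℂ)) ^ 6) ⊓
                Module.End.eigenspace (complexBetti.map (𝟙 B + ψF).hom.hom.hom 6).hom
                  ((1 + (Real.sqrt (t : ℝ) : ℂ)) ^ 6)) ⊔
              (Module.End.eigenspace (complexBetti.map (𝟙 B + ψK).hom.hom.hom 6).hom
                  ((1 + Complex.I * (Real.sqrt (7 : ℝ) : ℂ)) ^ 6) ⊓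
                Module.End.eigenspace (complexBetti.map (𝟙 B + ψF).hom.hom.hom 6).hom
                  ((1 - (Real.sqrt (t : ℝ) : ℂ)) ^ 6))) ⊔
             ((Module.End.eigenspace (complexBetti.map (𝟙 B + ψK).hom.hom.hom 6).hom
                  ((1 - Complex.I * (Real.sqrt (7 : ℝ) : ℂ)) ^ 6) ⊓
                Module.End.eigenspace (complexBetti.map (𝟙 B + ψF).hom.hom.hom 6).hom
                  ((1 + (Real.sqrt (t : ℝ) : ℂ)) ^ 6)) ⊔
              (Module.End.eigenspace (complexBetti.map (𝟙 B + ψK).hom.hom.hom 6).hom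
                  ((1 - Complex.I * (Real.sqrt (7 : ℝ) : ℂ)) ^ 6) ⊓
                Module.End.eigenspace (complexBetti.map (𝟙 B + ψF).hom.hom.hom 6).hom
                  ((1 - (Real.sqrt (t : ℝ) : ℂ)) ^ 6))) →
        c ∈ algebraicClasses B.X 3 := by
  intro B ψK ψF t hB hK hF hKF ht hsq hex c _ _ hcW
  obtain ⟨c₀, hc₀r, hc₀W, hc₀0, hc₀a⟩ := hex
  obtain ⟨y₁, hy₁, y₂, hy₂, rfl⟩ := Submodule.mem_sup.1 hc₀W
  obtain ⟨c₁, hc₁, c₂, hc₂, rfl⟩ := Submodule.mem_sup.1 hy₁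
  obtain ⟨c₃, hc₃, c₄, hc₄, rfl⟩ := Submodule.mem_sup.1 hy₂
  -- notation: the two operators, `s = i√7`, `r = √t`
  set TK := (complexBetti.map (𝟙 B + ψK).hom.hom.hom 6).hom with hTK_def
  set TF := (complexBetti.map (𝟙 B + ψF).hom.hom.hom 6).hom with hTF_def
  set s : ℂ := Complex.I * (Real.sqrt (7 : ℝ) : ℂ) with hs_def
  set r : ℂ := (Real.sqrt (t : ℝ) : ℂ) with hr_def
  have ht0 : (0 : ℝ) < Real.sqrt (t : ℝ) := Real.sqrt_pos.2 (by exact_mod_cast ht)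
  have h1r : (1 : ℝ) + Real.sqrt (t : ℝ) ≠ 0 := by positivity
  -- the characters are pairwise separated
  have hKsep : (1 + s) ^ 6 ≠ (1 - s) ^ 6 := weilEigenvalue_pos_ne_neg
  have hFsep : (1 + r) ^ 6 ≠ (1 - r) ^ 6 := by
    have h := one_add_pow_mul_one_sub_pow_ne_of_real ht0.ne' h1r (n := 6) (a := 0) (b := 6) rfl
      (by norm_num)
    rw [pow_zero, one_mul] at h
    exact fun e => h e.symm
  -- `(𝟙+ψ_K)^*`, `(𝟙+ψ_F)^*` preserve the algebraic classes (pull-back along endomorphisms) and `⊥`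
  have hSK : ∀ v ∈ algebraicClasses B.X 3, TK v ∈ algebraicClasses B.X 3 := fun v hv =>
    map_mem_algebraicClasses_of_abelianVariety (p := 3) AbelianVariety.isSmoothProjective_holds B _ hv
  have hSF : ∀ v ∈ algebraicClasses B.X 3, TF v ∈ algebraicClasses B.X 3 := fun v hv =>
    map_mem_algebraicClasses_of_abelianVariety (p := 3) AbelianVariety.isSmoothProjective_holds B _ hv
  -- the two operators and the four characters, indexed by `Bool` (`true ↦ K / +`, `false ↦ F / -`)
  let T : Bool → (complexBetti B.X 6 →ₗ[ℂ] complexBetti B.X 6) := fun p => cond p TK TF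
  let χ : Bool × Bool → Bool → ℂ := fun q p =>
    cond p (cond q.1 ((1 + s) ^ 6) ((1 - s) ^ 6)) (cond q.2 ((1 + r) ^ 6) ((1 - r) ^ 6))
  have hTS : ∀ p, ∀ v ∈ algebraicClasses B.X 3, T p v ∈ algebraicClasses B.X 3 := by
    rintro (_ | _) v hv
    · exact hSF v hv
    · exact hSK v hv
  have hTbot : ∀ p, ∀ v ∈ (⊥ : Submodule ℂ (complexBetti B.X 6)), T p v ∈ (⊥ : Submodule ℂ _) := by
    intro p v hv
    rw [(Submodule.mem_bot ℂ).1 hv, map_zero]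
    exact Submodule.zero_mem _
  have hχ : ∀ i ∈ (Finset.univ : Finset (Bool × Bool)), ∀ j ∈ (Finset.univ : Finset (Bool × Bool)),
      i ≠ j → ∃ p, χ i p ≠ χ j p := by
    rintro ⟨i₁, i₂⟩ - ⟨j₁, j₂⟩ - hij
    by_cases h₁ : i₁ = j₁
    · subst h₁
      refine ⟨false, ?_⟩
      rcases i₂ with _ | _ <;> rcases j₂ with _ | _
      · exact absurd rfl hij
      · exact hFsep.symm
      · exact hFsep
      · exact absurd rfl hij
    · refine ⟨true, ?_⟩
      rcases i₁ with _ | _ <;> rcases j₁ with _ | _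
      · exact absurd rfl h₁
      · exact hKsep.symm
      · exact hKsep
      · exact absurd rfl h₁
  -- the components `v` of `c₀` and the rearranged conjugate components `w`
  let v : Bool × Bool → complexBetti B.X 6 := fun q => cond q.1 (cond q.2 c₁ c₂) (cond q.2 c₃ c₄)
  let w : Bool × Bool → complexBetti B.X 6 := fun q =>
    cond q.1 (cond q.2 (conjClass (ComplexPoints B.X) 6 c₃) (conjClass (ComplexPoints B.X) 6 c₄))
      (cond q.2 (conjClass (ComplexPoints B.X) 6 c₁) (conjClass (ComplexPoints B.X) 6 c₂))
  have hsumv : ∑ q, v q = c₁ + c₂ + (c₃ + c₄) := by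
    rw [Fintype.sum_prod_type, Fintype.sum_bool, Fintype.sum_bool, Fintype.sum_bool]
    rfl
  have hsumw : ∑ q, w q = conjClass (ComplexPoints B.X) 6 c₃ + conjClass (ComplexPoints B.X) 6 c₄ +
      (conjClass (ComplexPoints B.X) 6 c₁ + conjClass (ComplexPoints B.X) 6 c₂) := by
    rw [Fintype.sum_prod_type, Fintype.sum_bool, Fintype.sum_bool, Fintype.sum_bool]
    rfl
  have hv : ∀ q ∈ (Finset.univ : Finset (Bool × Bool)), ∀ p, T p (v q) = χ q p • v q := by
    rintro ⟨_ | _, _ | _⟩ - (_ | _)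
    · exact Module.End.mem_eigenspace_iff.1 hc₄.2
    · exact Module.End.mem_eigenspace_iff.1 hc₄.1
    · exact Module.End.mem_eigenspace_iff.1 hc₃.2
    · exact Module.End.mem_eigenspace_iff.1 hc₃.1
    · exact Module.End.mem_eigenspace_iff.1 hc₂.2
    · exact Module.End.mem_eigenspace_iff.1 hc₂.1
    · exact Module.End.mem_eigenspace_iff.1 hc₁.2
    · exact Module.End.mem_eigenspace_iff.1 hc₁.1
  have hw : ∀ q ∈ (Finset.univ : Finset (Bool × Bool)), ∀ p, T p (w q) = χ q p • w q := by
    rintro ⟨_ | _, _ | _⟩ - (_ | _)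
    · exact Module.End.mem_eigenspace_iff.1 (conjClass_mem_eigenspace_real_sub hc₂.2)
    · exact Module.End.mem_eigenspace_iff.1 (conjClass_mem_eigenspace_pos hc₂.1)
    · exact Module.End.mem_eigenspace_iff.1 (conjClass_mem_eigenspace_real hc₁.2)
    · exact Module.End.mem_eigenspace_iff.1 (conjClass_mem_eigenspace_pos hc₁.1)
    · exact Module.End.mem_eigenspace_iff.1 (conjClass_mem_eigenspace_real_sub hc₄.2)
    · exact Module.End.mem_eigenspace_iff.1 (conjClass_mem_eigenspace_neg hc₄.1)
    · exact Module.End.mem_eigenspace_iff.1 (conjClass_mem_eigenspace_real hc₃.2)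
    · exact Module.End.mem_eigenspace_iff.1 (conjClass_mem_eigenspace_neg hc₃.1)
  -- (1) the four components are algebraic
  have halg : ∀ q ∈ (Finset.univ : Finset (Bool × Bool)), v q ∈ algebraicClasses B.X 3 :=
    mem_of_sum_eigenvectors_mem T (algebraicClasses B.X 3) hTS χ Finset.univ hχ v hv
      (by rw [hsumv]; exact hc₀a)
  -- (2) conjugation permutes the components: uniqueness of the joint decomposition
  have huniq : ∀ q ∈ (Finset.univ : Finset (Bool × Bool)),
      v q - w q ∈ (⊥ : Submodule ℂ (complexBetti B.X 6)) := by
    refine mem_of_sum_eigenvectors_mem T ⊥ hTbot χ Finset.univ hχ (fun q => v q - w q) ?_ ?_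
    · intro q hq p
      rw [map_sub, hv q hq p, hw q hq p, smul_sub]
    · rw [Finset.sum_sub_distrib, hsumv, hsumw, Submodule.mem_bot, sub_eq_zero]
      have hconj : conjClass (ComplexPoints B.X) 6 (c₁ + c₂ + (c₃ + c₄)) = c₁ + c₂ + (c₃ + c₄) :=
        hc₀r.conjClass_eq
      rw [conjClass_add, conjClass_add, conjClass_add] at hconj
      rw [← hconj]
      abel
  have e13 : c₁ = conjClass (ComplexPoints B.X) 6 c₃ :=
    sub_eq_zero.1 ((Submodule.mem_bot ℂ).1 (huniq (true, true) (Finset.mem_univ _)))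
  have e24 : c₂ = conjClass (ComplexPoints B.X) 6 c₄ :=
    sub_eq_zero.1 ((Submodule.mem_bot ℂ).1 (huniq (true, false) (Finset.mem_univ _)))
  have e31 : c₃ = conjClass (ComplexPoints B.X) 6 c₁ :=
    sub_eq_zero.1 ((Submodule.mem_bot ℂ).1 (huniq (false, true) (Finset.mem_univ _)))
  have e42 : c₄ = conjClass (ComplexPoints B.X) 6 c₂ :=
    sub_eq_zero.1 ((Submodule.mem_bot ℂ).1 (huniq (false, false) (Finset.mem_univ _)))
  -- (3) all four components are non-zero: `c₀` is a rational class, not an eigenvector of `(𝟙+ψ_F)^*`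
  have hirr : Irrational (Real.sqrt (t : ℝ)) := irrational_sqrt_natCast_iff.2 hsq
  have hρ2 : Real.sqrt (t : ℝ) ^ 2 = t := Real.sq_sqrt (Nat.cast_nonneg _)
  have hFp_irr : ∀ q : ℚ, (1 + r) ^ 6 ≠ (q : ℂ) := one_add_pow_six_ne_ratCast hirr hρ2
  have hFm_irr : ∀ q : ℚ, (1 - r) ^ 6 ≠ (q : ℂ) := by
    intro q
    have h := one_add_pow_six_ne_ratCast hirr.neg (by rw [neg_sq, hρ2]) q
    rwa [Complex.ofReal_neg, ← sub_eq_add_neg] at h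
  have hc₀F : ∀ {μ : ℂ}, c₁ + c₂ + (c₃ + c₄) ∈ Module.End.eigenspace TF μ → ∃ q : ℚ, (q : ℂ) = μ :=
    fun hμ => mem_range_ratCast_of_isRationalClass_of_mem_eigenspace (𝟙 B + ψF) hc₀r hc₀0 hμ
  have h13 : c₁ ≠ 0 ∧ c₃ ≠ 0 := by
    suffices h : ¬ (c₁ = 0 ∧ c₃ = 0) by
      refine ⟨fun h1 => h ⟨h1, ?_⟩, fun h3 => h ⟨?_, h3⟩⟩
      · rw [e31, h1, conjClass_zero]
      · rw [e13, h3, conjClass_zero]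
    rintro ⟨h1, h3⟩
    have hmem : c₁ + c₂ + (c₃ + c₄) ∈ Module.End.eigenspace TF ((1 - r) ^ 6) := by
      rw [h1, h3, zero_add, zero_add]
      exact Submodule.add_mem _ hc₂.2 hc₄.2
    obtain ⟨q, hq⟩ := hc₀F hmem
    exact hFm_irr q hq.symm
  have h24 : c₂ ≠ 0 ∧ c₄ ≠ 0 := by
    suffices h : ¬ (c₂ = 0 ∧ c₄ = 0) by
      refine ⟨fun h2 => h ⟨h2, ?_⟩, fun h4 => h ⟨?_, h4⟩⟩
      · rw [e42, h2, conjClass_zero]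
      · rw [e24, h4, conjClass_zero]
    rintro ⟨h2, h4⟩
    have hmem : c₁ + c₂ + (c₃ + c₄) ∈ Module.End.eigenspace TF ((1 + r) ^ 6) := by
      rw [h2, h4, add_zero, add_zero]
      exact Submodule.add_mem _ hc₁.2 hc₃.2
    obtain ⟨q, hq⟩ := hc₀F hmem
    exact hFp_irr q hq.symm
  -- (4) the four joint eigenspaces are lines, each through a non-zero algebraic class
  obtain ⟨w₁, hw₁⟩ := oneClassSuffices_jointEigenline ψK ψF t hB hK hF hKF ht hsq
    (Or.inl rfl) (Or.inl rfl)
  obtain ⟨w₂, hw₂⟩ := oneClassSuffices_jointEigenline ψK ψF t hB hK hF hKF ht hsq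
    (Or.inl rfl) (Or.inr rfl)
  obtain ⟨w₃, hw₃⟩ := oneClassSuffices_jointEigenline ψK ψF t hB hK hF hKF ht hsq
    (Or.inr rfl) (Or.inl rfl)
  obtain ⟨w₄, hw₄⟩ := oneClassSuffices_jointEigenline ψK ψF t hB hK hF hKF ht hsq
    (Or.inr rfl) (Or.inr rfl)
  rw [← sub_eq_add_neg] at hw₂ hw₃
  rw [← sub_eq_add_neg, ← sub_eq_add_neg] at hw₄
  have hle₁ := le_of_le_span_singleton_of_mem hw₁ hc₁ h13.1 (halg (true, true) (Finset.mem_univ _))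
  have hle₂ := le_of_le_span_singleton_of_mem hw₂ hc₂ h24.1 (halg (true, false) (Finset.mem_univ _))
  have hle₃ := le_of_le_span_singleton_of_mem hw₃ hc₃ h13.2 (halg (false, true) (Finset.mem_univ _))
  have hle₄ := le_of_le_span_singleton_of_mem hw₄ hc₄ h24.2 (halg (false, false) (Finset.mem_univ _))
  exact sup_le (sup_le hle₁ hle₂) (sup_le hle₃ hle₄) hcW

end Stub

end Summit.HodgeConjecture.HodgeConjecture.Theorems.WeilSixfoldsSqrtMinus7.RealQuadraticBaseChange

end
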